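import Summits.QuantumFields.GaugeBoot.OneOverNFreeEnergyExpansion
import HarnessLib

/-!
# The first `1/N` correction to Chatterjee's limiting free energy, and the expansion along power cubes (gauge-boot, ADDENDUM 30 part M)

HONEST FRAMING (cell `pub-gaugeboot`, page 1 of every file): the venture produces certified bounds
on lattice expectations at stated coupling, gauge group, dimension and torus size; NOT a mass gap,
NOT a continuum limit, NOT a string tension; NOT Yang–Mills-summit-bearing (barriers
`FixedCouplingUltralocality`, `PerturbativeInvisibility`).  Strong-coupling `SO(N)` lattice gauge theory with free boundary
condition (S. Chatterjee, Comm. Math. Phys. **366** (2019); S. Chatterjee, J. Jafarov, arXiv:1604.04777); nothing about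
four-dimensional continuum Yang–Mills or a mass gap.

## Content

★★★ `freeEnergy_firstOrder` — the FIRST `1/N` CORRECTION TO COROLLARY 3.4 of Chatterjee 2019: for `|β| ≤ β₁(d)`, cubes
`Λ_N = [−M_N, M_N]^d` with `M_N → ∞`, `N²/M_N → 0`, and any plaquette `p`,

  `N · ( log Z_{Λ_N,N,β}/(N²|Λ_N|) − (β d(d−1)/2) Σ_{X ∈ 𝒳((∂p))} w_β(X)/(δ(X)+1) ) ⟶ (d(d−1)/2) ∫₀^β f_1(t, (∂p)) dt`,

where `f_1` is the first-order coefficient of the `1/N` expansion of Wilson loop expectations (`N(⟨W⟩/Nⁿ − Σ_X w_β(X)) → f_1`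
along super-logarithmic cubes; ADDENDUM 29's `ψ_β`).  ★ `oneOverN_freeEnergy_powerCubes` — the all-order free-energy expansion
of the sibling instantiated on the cubes `[−N^{k+2}, N^{k+2}]^d`.

Everything is `[folklore]` given the siblings.
-/

noncomputable section

open Filter Topology MeasureTheory
open Literature.Probability.LatticeModels (Site box)
open Literature.MathematicalPhysics.QuantumLattice (ZdEdge ZdPlaquette)
open Literature.MathematicalPhysics.QuantumFieldTheory (latticeNorm plaquettesIn)
open Literature.MathematicalPhysics.QuantumFieldTheory.Chatterjee2019LargeN
open Literature.MathematicalPhysics.QuantumFieldTheory.Chatterjee2019LargeN.CoeffCatalanBoundProof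

namespace Summit.QuantumFields.GaugeBoot

namespace StringDuality

variable {d : ℕ}

/-- `|t| ≤ |β|` on the closed integration interval `uIcc 0 β`. [folklore] -/
theorem abs_le_of_mem_uIcc {β t : ℝ} (ht : t ∈ Set.uIcc 0 β) : |t| ≤ |β| := by
  rw [Set.mem_uIcc] at ht
  rcases ht with ⟨h1, h2⟩ | ⟨h1, h2⟩
  · rw [abs_of_nonneg h1]; exact h2.trans (le_abs_self β)
  · rw [abs_le]; constructor <;> linarith [neg_abs_le β, le_abs_self β]

variable (d)

/-- ★★★ **The first `1/N` correction to the limiting free energy (Chatterjee's Corollary 3.4 at the next order).**  See the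
module docstring; `F 3 β` is the first-order coefficient `f_1(β, ·)`, characterised here by the convergence
`N(⟨W_{l₁}⋯W_{lₙ}⟩_{Λ_N,N,β}/Nⁿ − Σ_X w_β(X)) → F 3 β s` along every super-logarithmic sequence of cubes.
[cite: Chatterjee2019LargeN, Corollary 3.4; ChatterjeeJafarov2016OneOverN, Theorem 3.1] -/
theorem freeEnergy_firstOrder (hd : 2 ≤ d) :
    ∃ β₁ : ℝ, 0 < β₁ ∧ ∃ F : ℕ → ℝ → LoopSeq d → ℝ,
      (∀ β : ℝ, |β| ≤ β₁ → ∀ M : ℕ → ℕ, (∀ a : ℕ, ∀ᶠ N : ℕ in atTop, a * Nat.log 2 N ≤ M N) →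
        ∀ s : LoopSeq d, IsLoopSeq s →
          Tendsto (fun N : ℕ => (N : ℝ) * (phi N β (box d (M N)) s - ∑' X : Trajectory s, X.weight β)) atTop
            (𝓝 (F 3 β s))) ∧
      ∀ β : ℝ, |β| ≤ β₁ → ∀ M : ℕ → ℕ, Tendsto M atTop atTop →
        Tendsto (fun N : ℕ => (N : ℝ) ^ 2 / (M N : ℝ)) atTop (𝓝 0) → ∀ p : ZdPlaquette d,
          Summable (fun X : Trajectory [plaquetteWord p] => X.weight β / (X.numDeform + 1)) ∧
          Tendsto (fun N : ℕ => (N : ℝ) *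
              (Real.log (soPartitionFunction N β (box d (M N))) / ((N : ℝ) ^ 2 * (box d (M N)).card)
                - β * d * ((d : ℝ) - 1) / 2 * ∑' X : Trajectory [plaquetteWord p], X.weight β / (X.numDeform + 1))) atTop
            (𝓝 ((d : ℝ) * ((d : ℝ) - 1) / 2 * ∫ t in (0 : ℝ)..β, F 3 t [plaquetteWord p])) := by
  obtain ⟨β₀, hpos, hanti, F, hF0, hF1, hConv, HB, -, hFE⟩ := oneOverN_freeEnergy d hd
  obtain ⟨β₂, hβ₂, H2⟩ := integral_trajectorySum_eq d
  have h20 : β₀ 2 ≤ β₀ 0 := (hanti 1).trans (hanti 0)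
  have h21 : β₀ 2 ≤ β₀ 1 := hanti 1
  refine ⟨min (β₀ 2) β₂, lt_min (hpos 2) hβ₂, F, fun β hβ M hM s hs => ?_, fun β hβ M hM' hM p => ?_⟩
  · -- the first-order coefficient: `k = 1` of the expansion, with `f_0 = T`
    have hb1 : |β| ≤ β₀ 1 := hβ.trans ((min_le_left _ _).trans h21)
    have hb0 : |β| ≤ β₀ 0 := hb1.trans (hanti 0)
    have h := hConv 1 β hb1 M hM s hs
    simp only [pow_one, Finset.sum_range_one, pow_zero, div_one] at h
    rw [HB β hb0 s hs] at h
    exact h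
  · have hb2 : |β| ≤ β₀ 2 := hβ.trans (min_le_left _ _)
    have hbβ₂ : |β| ≤ β₂ := hβ.trans (min_le_right _ _)
    obtain ⟨hsum, hint⟩ := H2 β hbβ₂ p
    refine ⟨hsum, ?_⟩
    have h := hFE 1 β hb2 M hM' hM p
    simp only [pow_one, Finset.sum_range_one, pow_zero, div_one] at h
    -- `∫₀^β f_0(t, ∂p) dt = ∫₀^β Σ_X w_t(X) dt = β Σ_X w_β(X)/(δ(X)+1)`
    have hcongr : ∫ t in (0 : ℝ)..β, F 2 t [plaquetteWord p] =
        ∫ t in (0 : ℝ)..β, ∑' X : Trajectory [plaquetteWord p], X.weight t := by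
      refine intervalIntegral.integral_congr fun t ht => ?_
      have ht0 : |t| ≤ β₀ 0 := ((abs_le_of_mem_uIcc ht).trans hb2).trans h20
      exact HB t ht0 _ (isLoopSeq_plaquette p)
    rw [hcongr, hint] at h
    refine h.congr' (Eventually.of_forall fun N => ?_)
    simp only
    ring_nf

/-- ★ **The free-energy expansion along power cubes**: with `F` as in `oneOverN_freeEnergy` (re-obtained here), for every `k`,
`|β| ≤ β₀(d,k+1)` and any plaquette `p`, along `Λ_N = [−N^{k+2}, N^{k+2}]^d`:
`N^k(log Z_{Λ_N,N,β}/(N²|Λ_N|) − Σ_{i<k} N^{−i}(d(d−1)/2)∫₀^β f_i) → (d(d−1)/2)∫₀^β f_k`.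
[cite: Chatterjee2019LargeN, Corollary 3.4; ChatterjeeJafarov2016OneOverN, Theorem 3.1] -/
theorem oneOverN_freeEnergy_powerCubes (hd : 2 ≤ d) :
    ∃ β₀ : ℕ → ℝ, (∀ k, 0 < β₀ k) ∧ ∃ F : ℕ → ℝ → LoopSeq d → ℝ,
      (∀ (k : ℕ) (β : ℝ), |β| ≤ β₀ k → ∀ M : ℕ → ℕ, (∀ a : ℕ, ∀ᶠ N : ℕ in atTop, a * Nat.log 2 N ≤ M N) →
        ∀ s : LoopSeq d, IsLoopSeq s → Tendsto (fun N : ℕ => (N : ℝ) ^ k *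
          (phi N β (box d (M N)) s - ∑ i ∈ Finset.range k, F (i + 2) β s / (N : ℝ) ^ i)) atTop (𝓝 (F (k + 2) β s))) ∧
      ∀ (k : ℕ) (β : ℝ), |β| ≤ β₀ (k + 1) → ∀ p : ZdPlaquette d,
        Tendsto (fun N : ℕ => (N : ℝ) ^ k *
            (Real.log (soPartitionFunction N β (box d (N ^ (k + 2)))) / ((N : ℝ) ^ 2 * (box d (N ^ (k + 2))).card)
              - ∑ i ∈ Finset.range k,
                  ((d : ℝ) * ((d : ℝ) - 1) / 2 * ∫ t in (0 : ℝ)..β, F (i + 2) t [plaquetteWord p]) / (N : ℝ) ^ i)) atTop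
          (𝓝 ((d : ℝ) * ((d : ℝ) - 1) / 2 * ∫ t in (0 : ℝ)..β, F (k + 2) t [plaquetteWord p])) := by
  obtain ⟨β₀, hpos, -, F, -, -, hConv, -, -, hFE⟩ := oneOverN_freeEnergy d hd
  refine ⟨β₀, hpos, F, hConv, fun k β hβ p => hFE k β hβ (fun N => N ^ (k + 2)) ?_ ?_ p⟩
  · exact tendsto_atTop_atTop.mpr fun b => ⟨b, fun N hN => hN.trans (Nat.le_self_pow (by omega) N)⟩
  · have h1 : Tendsto (fun N : ℕ => (1 : ℝ) / (N : ℝ)) atTop (𝓝 0) := tendsto_const_div_atTop_nhds_zero_nat 1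
    refine h1.congr' ?_
    filter_upwards [eventually_ge_atTop 1] with N hN
    have hN0 : (N : ℝ) ≠ 0 := by exact_mod_cast (by omega : N ≠ 0)
    push_cast
    rw [pow_succ ((N : ℝ)) (k + 1)]
    field_simp

end StringDuality

end Summit.QuantumFields.GaugeBoot

end
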